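import Summits.RiemannHypothesis.RiemannHypothesis.Theorems.Splittings.NbMertensZerosFloor
import Literature.NumberTheory.LFunctions.MertensCertificate.Chunk00
import Literature.NumberTheory.LFunctions.MertensCertificate.Chunk01
import Literature.NumberTheory.LFunctions.MertensCertificate.Chunk02
import Literature.NumberTheory.LFunctions.MertensCertificate.Chunk03
import Literature.NumberTheory.LFunctions.MertensCertificate.Chunk04
import Literature.NumberTheory.LFunctions.MertensCertificate.Chunk05
import Literature.NumberTheory.LFunctions.MertensCertificate.Chunk06
import Literature.NumberTheory.LFunctions.MertensCertificate.Chunk07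
import Literature.NumberTheory.LFunctions.MertensCertificate.Chunk08
import Literature.NumberTheory.LFunctions.MertensCertificate.Chunk09
import Literature.NumberTheory.LFunctions.MertensCertificate.Chunk10
import Literature.NumberTheory.LFunctions.MertensCertificate.Chunk11
import Literature.NumberTheory.LFunctions.MertensCertificate.Chunk12
import Literature.NumberTheory.LFunctions.MertensCertificate.Chunk13
import Literature.NumberTheory.LFunctions.MertensCertificate.Chunk14
import Literature.NumberTheory.LFunctions.MertensCertificate.Chunk15
import Literature.NumberTheory.LFunctions.MertensCertificate.Chunk16
import Literature.NumberTheory.LFunctions.MertensCertificate.Chunk17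
import Literature.NumberTheory.LFunctions.MertensCertificate.Chunk18
import Literature.NumberTheory.LFunctions.MertensCertificate.Chunk19
import Literature.NumberTheory.LFunctions.SchoenfeldZerosLow
import HarnessLib

/-!
# NB Burnol floor over the 2000 Odlyzko–te Riele zeros — compiled evaluation and assembly (SPLIT-nb-neg gen 8, §14)

Cell rh-split, seat rh-split-nb-neg g8 (brief sha16 f79c5f09d8bcb036), card
`run/shared/lean/pub/rh-split/cards/SPLIT-nb-neg.md` §14.  Sibling of `NbMertensZerosFloor.lean` (standard
axioms, hypothesis form).  This file discharges the two computational hypotheses of that file and assembles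
the unconditional corollaries, exactly as the tree assembles `OdlyzkoTeRiele1985_numerics_holds`
(`Literature/NumberTheory/LFunctions/RHWave0MertensProofs.lean`):

* `checkChunk_all` — the twenty block checks = the tree's `SchoenfeldBound.checkChunk_all` (compiled evaluations
  `checkChunk_00 … _19`, `MertensCertificate/Chunk00.lean … Chunk19.lean`, one `native_decide` each), re-exported here;
* `zeroSum_check` — the ONE new computation: the exact integer comparison
  `26117558415922292 ≤ Σ_{j<2000} ⌊2⁵⁴⁰/(2⁴⁷⁸ + (a_j+1)²)⌋` (2000 big-integer divisions), by `native_decide`;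
* the assembled corollaries `exists_finset_zeros_sum_ge_mertens` (`Σ m²/|ρ|² ≥ 0.045306` over a finite set
  of certified critical zeros — tree: `0.03407`), `lt_const_of_frequently_nbRateBound_mertens` /
  `lt_const_of_eventually_nbRateBound_mertens` (`0.28467 < C` — tree: `0.214`),
  `not_nb_rateTail_of_lt_mertens`, `not_nb_halfDoublingTail_of_certificate_mertens`,
  `nb_levelFloor_of_halfDoublingTail_mertens`.

AXIOMS: every theorem here depends on `propext`, `Classical.choice`, `Quot.sound` AND on the `native_decide`
auxiliary axioms (`Lean.ofReduceBool` / `Lean.trustCompiler` family) of `checkChunk_00 … checkChunk_19` (tree) and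
of `zeroSum_check` (this file) — proposal flag `computational`, like the tree's Mertens disproof assembly.  The
hypothesis-form theorems of `NbMertensZerosFloor.lean` stay on the standard axioms.
HONEST LABEL: «SPLITTING SEARCH over kernel-typed RH-EQUIVALENCES; a splitting A ∧ B ⟹ RH is CONDITIONAL
bookkeeping unless A and B are both proved; nothing here bears on the truth of RH.»
-/

set_option linter.dupNamespace false

noncomputable section

open Complex MeasureTheory Set Filter Topology
open scoped Real ENNReal

namespace Summit.RiemannHypothesis.RiemannHypothesis.Theorems.Splittings.NbMertensZerosFloor

open Literature.NumberTheory.LFunctions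
open Literature.NumberTheory.LFunctions.ZetaNumerics.Mertens
open Literature.NumberTheory.LFunctions.MertensCertificate.ZetaNumerics.Mertens

/-! ## 1. The two computational inputs -/

/- **All twenty block checks pass** — this is the tree's
`Literature.NumberTheory.LFunctions.SchoenfeldBound.checkChunk_all` (`SchoenfeldZerosLow.lean`, the same twenty compiled
evaluations `checkChunk_00 … checkChunk_19` [OdlyzkoTeRiele1985, §4.2 p. 151]); it is RE-EXPORTED into this namespace so that the
call sites below and in `NbBurnolFloorRunsEval` keep the short name (typer-1 g5 dedup repair: the gate refuses a restated copy). -/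
export Literature.NumberTheory.LFunctions.SchoenfeldBound (checkChunk_all)

/-- **The integer comparison** `26117558415922292 ≤ Σ_{j<2000} ⌊2⁵⁴⁰/(2⁴⁷⁸ + (a_j+1)²)⌋` (in fact an
equality), ONE compiled exact big-integer evaluation (`native_decide`; proposal flag `computational`).
[folklore] -/
theorem zeroSum_check :
    (26117558415922292 : ℤ) ≤ ∑ j ∈ Finset.range NZ, (2 : ℤ) ^ 540 / (2 ^ 478 + (ordinate j + 1) ^ 2) := by
  native_decide

/-! ## 2. Assembled corollaries (unconditional; closure `+ Lean.ofReduceBool`) -/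

/-- **2000 certified zero pairs**: a finite set of critical zeros of `ζ` with `Σ m_ρ²/|ρ|² ≥ 0.045306`
(`98.08 %` of the RH value `2+γ−log 4π = 0.046191…`; tree `exists_finset_zeros_sum_ge`: `0.03407`).
[cite: OdlyzkoTeRiele1985, §4.2 p. 151] [cite: Burnol2002, Thm. 1.3] -/
theorem exists_finset_zeros_sum_ge_mertens : ∃ G : Finset ℂ, (∀ ρ ∈ G, riemannZeta ρ = 0 ∧ ρ.re = 1 / 2) ∧
    (45306 : ℝ) / 1000000 ≤ ∑ ρ ∈ G, (riemannZetaZeroOrder ρ : ℝ) ^ 2 / ‖ρ‖ ^ 2 := by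
  obtain ⟨G, hG, hsum⟩ := exists_finset_zeros_sum_ge_of_checks checkChunk_all
  have h2 := sum_inv_ge_of_check zeroSum_check
  exact ⟨G, hG, by linarith⟩

/-- **Every frequently admissible NB rate constant exceeds `0.28467`** (tree: `0.214`).
[cite: Burnol2002, Thm. 1.3] [cite: BDBLS2000, conjecture] -/
theorem lt_const_of_frequently_nbRateBound_mertens {C : ℝ}
    (hC : ∃ᶠ N : ℕ in atTop, ∃ a : Fin N → ℂ, ∫⁻ t : ℝ, ENNReal.ofReal (‖1 - riemannZeta (1 / 2 + t * Complex.I) *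
        ∑ n : Fin N, a n * ((n : ℂ) + 1) ^ (-(1 / 2 + t * Complex.I))‖ ^ 2 / (1 / 4 + t ^ 2)) ≤
      ENNReal.ofReal (C / Real.log N)) :
    (28467 : ℝ) / 100000 < C :=
  lt_const_of_frequently_nbRateBound_of_checks checkChunk_all zeroSum_check hC

/-- **Every eventually admissible NB rate constant exceeds `0.28467`** (tree
`lt_const_of_eventually_nbRateBound`: `0.214`). [cite: Burnol2002, Thm. 1.3] -/
theorem lt_const_of_eventually_nbRateBound_mertens {C : ℝ}
    (hC : ∀ᶠ N : ℕ in atTop, ∃ a : Fin N → ℂ, ∫⁻ t : ℝ, ENNReal.ofReal (‖1 - riemannZeta (1 / 2 + t * Complex.I) *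
        ∑ n : Fin N, a n * ((n : ℂ) + 1) ^ (-(1 / 2 + t * Complex.I))‖ ^ 2 / (1 / 4 + t ^ 2)) ≤
      ENNReal.ofReal (C / Real.log N)) :
    (28467 : ℝ) / 100000 < C :=
  lt_const_of_eventually_nbRateBound_of_checks checkChunk_all zeroSum_check hC

/-- **`TailRate(C, H)` is false for every `C < 0.28467` and every `H`** (tree `not_nb_rateTail_of_le`:
`C ≤ 0.214`). [cite: Burnol2002, Thm. 1.3] -/
theorem not_nb_rateTail_of_lt_mertens {C : ℝ} (hC : C < 28467 / 100000) (H : ℕ) :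
    ¬ ∀ N : ℕ, H ≤ N → ∃ a : Fin N → ℂ,
      ∫⁻ t : ℝ, ENNReal.ofReal (‖1 - riemannZeta (1 / 2 + t * Complex.I) *
        ∑ n : Fin N, a n * ((n : ℂ) + 1) ^ (-(1 / 2 + t * Complex.I))‖ ^ 2 / (1 / 4 + t ^ 2)) ≤
      ENNReal.ofReal (C / Real.log N) :=
  not_nb_rateTail_of_lt_of_checks checkChunk_all zeroSum_check hC H

/-- **`TailDoubling(½, H)` is refuted by ONE certificate `I(N₀,a₀) ≤ c/log N₀`, `c < 0.28467`,
`N₀ ≥ max(H,2)`** (tree `not_nb_halfDoublingTail_of_certificate`: `c < 0.214`, met by no level).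
[cite: Burnol2002, Thm. 1.3] [cite: BDBLS2000, conjecture] -/
theorem not_nb_halfDoublingTail_of_certificate_mertens {H N₀ : ℕ} (hH : H ≤ N₀) (h2 : 2 ≤ N₀) {c : ℝ}
    (hc : c < 28467 / 100000) (a₀ : Fin N₀ → ℂ)
    (hw : ∫⁻ t : ℝ, ENNReal.ofReal (‖1 - riemannZeta (1 / 2 + t * Complex.I) *
        ∑ n : Fin N₀, a₀ n * ((n : ℂ) + 1) ^ (-(1 / 2 + t * Complex.I))‖ ^ 2 / (1 / 4 + t ^ 2)) ≤
      ENNReal.ofReal (c / Real.log N₀)) :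
    ¬ ∀ N : ℕ, H ≤ N →
      (⨅ a : Fin (N ^ 2) → ℂ, ∫ t : ℝ, ‖1 - riemannZeta (1 / 2 + t * I) *
        ∑ n : Fin (N ^ 2), a n * ((n : ℂ) + 1) ^ (-(1 / 2 + t * I))‖ ^ 2 / (1 / 4 + t ^ 2)) ≤
      1 / 2 * (⨅ a : Fin N → ℂ, ∫ t : ℝ, ‖1 - riemannZeta (1 / 2 + t * I) *
        ∑ n : Fin N, a n * ((n : ℂ) + 1) ^ (-(1 / 2 + t * I))‖ ^ 2 / (1 / 4 + t ^ 2)) :=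
  not_nb_halfDoublingTail_of_certificate_of_checks checkChunk_all zeroSum_check hH h2 hc a₀ hw

/-- **`TailDoubling(½, H)` predicts the per-level floor `0.28467/log N` at every `N ≥ max(H,2)`**
(tree `nb_levelFloor_of_halfDoublingTail`: `0.214/log N`). [cite: Burnol2002, Thm. 1.3] -/
theorem nb_levelFloor_of_halfDoublingTail_mertens {H : ℕ}
    (h : ∀ N : ℕ, H ≤ N →
      (⨅ a : Fin (N ^ 2) → ℂ, ∫ t : ℝ, ‖1 - riemannZeta (1 / 2 + t * I) *
        ∑ n : Fin (N ^ 2), a n * ((n : ℂ) + 1) ^ (-(1 / 2 + t * I))‖ ^ 2 / (1 / 4 + t ^ 2)) ≤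
      1 / 2 * (⨅ a : Fin N → ℂ, ∫ t : ℝ, ‖1 - riemannZeta (1 / 2 + t * I) *
        ∑ n : Fin N, a n * ((n : ℂ) + 1) ^ (-(1 / 2 + t * I))‖ ^ 2 / (1 / 4 + t ^ 2)))
    {N : ℕ} (hH : H ≤ N) (h2 : 2 ≤ N) (a : Fin N → ℂ) :
    ENNReal.ofReal (28467 / 100000 / Real.log N) ≤
      ∫⁻ t : ℝ, ENNReal.ofReal (‖1 - riemannZeta (1 / 2 + t * Complex.I) *
        ∑ n : Fin N, a n * ((n : ℂ) + 1) ^ (-(1 / 2 + t * Complex.I))‖ ^ 2 / (1 / 4 + t ^ 2)) :=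
  nb_levelFloor_of_halfDoublingTail_of_checks checkChunk_all zeroSum_check h hH h2 a

end Summit.RiemannHypothesis.RiemannHypothesis.Theorems.Splittings.NbMertensZerosFloor

end
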